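import Mathlib
import Summits.CriticalPhenomena.Ising3DConformalLimit.Theorems.PrecisionLaplacianEtaBoundsTransferTestFn
import Literature.Probability.LatticeModels.HighDimTrivialityUniformProofs
import HarnessLib

/-!
# Shell sums of the stable-like kernel and the test-function lower bound on box sums

Helper file for item `stmt-CriticalPhenomena-4804`
(`Summit.CriticalPhenomena.Ising3DConformalLimit.Theses.PrecisionLaplacian.EtaBoundsTransfer`), part of its
unconditional proof: potential theory of inverse M-matrices ⇒ infinite-volume equation and Green-function
representation; Fourier analysis on `[-π,π]^d` ⇒ block-sum upper bounds; quadratic test function ⇒ ball-sum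
lower bounds; Messager–Miracle-Solé ⇒ pointwise two-sided power bounds. No definitions are introduced: the
objects (kernel matrices, box sequences, convolution powers) enter through defining hypotheses.
-/

namespace Summit.CriticalPhenomena.Ising3DConformalLimit.Theorems.EtaBoundsTransfer

open Finset Real Filter Topology MeasureTheory Literature.Probability.LatticeModels
open scoped BigOperators

section Shell

variable {d : ℕ}

/-- `∑_{m=1}^{R} m^{1−α} ≤ (1 + 1/(2−α)) R^{2−α}` for `1 < α < 2`, `R ≥ 1`
(integral comparison for the decreasing function `t^{1−α}`). -/
theorem sum_Icc_rpow_one_sub_le {α : ℝ} (hα1 : 1 < α) (hα2 : α < 2) {R : ℕ} (hR : 1 ≤ R) :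
    ∑ m ∈ Finset.Icc 1 R, (m : ℝ) ^ (1 - α) ≤ (1 + 1 / (2 - α)) * (R : ℝ) ^ (2 - α) := by
  have hR1 : (1 : ℝ) ≤ R := by exact_mod_cast hR
  have h2α : 0 < 2 - α := by linarith
  set f : ℝ → ℝ := fun t => t ^ (1 - α) with hf
  -- `∑_{m=1}^R f m = f 1 + ∑_{i ∈ Ico 1 R} f (i+1)`
  have hsplit : ∑ m ∈ Finset.Icc 1 R, f m = f 1 + ∑ i ∈ Finset.Ico 1 R, f ((i + 1 : ℕ) : ℝ) := by
    rw [← Finset.Ico_add_one_right_eq_Icc, Finset.sum_eq_sum_Ico_succ_bot (by omega),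
      Finset.sum_Ico_add' (fun i : ℕ => f i) 1 R 1]
    push_cast
    rfl
  have hanti : AntitoneOn f (Set.Icc ((1 : ℕ) : ℝ) R) := by
    intro x hx y _ hxy
    rw [Nat.cast_one] at hx
    exact Real.rpow_le_rpow_of_nonpos (by linarith [hx.1]) hxy (by linarith)
  have hint := AntitoneOn.sum_le_integral_Ico hR hanti
  rw [Nat.cast_one] at hint
  have hval : ∫ t in (1 : ℝ)..R, f t = ((R : ℝ) ^ (2 - α) - 1) / (2 - α) := by
    simp only [hf]
    rw [integral_rpow (Or.inr ⟨by linarith, ?_⟩)]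
    · rw [show 1 - α + 1 = 2 - α by ring, Real.one_rpow]
    · rw [Set.uIcc_of_le hR1]; exact fun h => by linarith [h.1]
  have hf1 : f 1 = 1 := by simp [hf]
  have hRpow : 1 ≤ (R : ℝ) ^ (2 - α) := Real.one_le_rpow hR1 h2α.le
  calc ∑ m ∈ Finset.Icc 1 R, (m : ℝ) ^ (1 - α) = f 1 + ∑ i ∈ Finset.Ico 1 R, f ((i + 1 : ℕ) : ℝ) := hsplit
    _ ≤ 1 + ((R : ℝ) ^ (2 - α) - 1) / (2 - α) := by rw [hf1, ← hval]; linarith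
    _ ≤ (1 + 1 / (2 - α)) * (R : ℝ) ^ (2 - α) := by
        rw [add_mul, one_mul, div_mul_eq_mul_div, one_mul]
        have : ((R : ℝ) ^ (2 - α) - 1) / (2 - α) ≤ (R : ℝ) ^ (2 - α) / (2 - α) :=
          div_le_div_of_nonneg_right (by linarith) h2α.le
        linarith

/-- `∑_{m=R+1}^{N} m^{−1−α} ≤ R^{−α}/α` for `α > 0`, `R ≥ 1`
(integral comparison for the decreasing function `t^{−1−α}`). -/
theorem sum_Ioc_rpow_neg_le {α : ℝ} (hα : 0 < α) {R : ℕ} (hR : 1 ≤ R) (N : ℕ) :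
    ∑ m ∈ Finset.Ioc R N, (m : ℝ) ^ (-1 - α) ≤ (R : ℝ) ^ (-α) / α := by
  have hR1 : (1 : ℝ) ≤ R := by exact_mod_cast hR
  have hR0 : (0 : ℝ) < R := by linarith
  rcases le_or_gt N R with hNR | hNR
  · rw [Finset.Ioc_eq_empty (by omega), Finset.sum_empty]
    positivity
  set f : ℝ → ℝ := fun t => t ^ (-1 - α) with hf
  have hre : ∑ m ∈ Finset.Ioc R N, f m = ∑ i ∈ Finset.Ico R N, f ((i + 1 : ℕ) : ℝ) := by
    rw [Finset.sum_Ico_add' (fun i : ℕ => f i) R N 1, Finset.Ico_add_one_add_one_eq_Ioc]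
  have hanti : AntitoneOn f (Set.Icc (R : ℝ) N) := by
    intro x hx y _ hxy
    exact Real.rpow_le_rpow_of_nonpos (by linarith [hx.1]) hxy (by linarith)
  have hint := AntitoneOn.sum_le_integral_Ico hNR.le hanti
  have hval : ∫ t in (R : ℝ)..N, f t = (((N : ℝ)) ^ (-α) - (R : ℝ) ^ (-α)) / (-α) := by
    simp only [hf]
    rw [integral_rpow (Or.inr ⟨by linarith, ?_⟩)]
    · rw [show -1 - α + 1 = -α by ring]
    · rw [Set.uIcc_of_le (by exact_mod_cast hNR.le)]; exact fun h => by linarith [h.1]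
  have hNpow : 0 ≤ ((N : ℝ)) ^ (-α) := Real.rpow_nonneg (Nat.cast_nonneg N) _
  calc ∑ m ∈ Finset.Ioc R N, (m : ℝ) ^ (-1 - α) = ∑ i ∈ Finset.Ico R N, f ((i + 1 : ℕ) : ℝ) := hre
    _ ≤ (((N : ℝ)) ^ (-α) - (R : ℝ) ^ (-α)) / (-α) := by rw [← hval]; exact hint
    _ = ((R : ℝ) ^ (-α) - (N : ℝ) ^ (-α)) / α := by rw [div_neg, ← neg_div, neg_sub]
    _ ≤ (R : ℝ) ^ (-α) / α := div_le_div_of_nonneg_right (by linarith) hα.le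

/-- **The one-dimensional shell sum**: for `1 < α < 2`, `R ≥ 1` and any `N`,
`∑_{m=1}^{N} m^{−1−α} min(1, d m²/R²) ≤ (d(1 + 1/(2−α)) + 1/α) R^{−α}`. -/
theorem shell_sum_1d_le {α : ℝ} (hα1 : 1 < α) (hα2 : α < 2) {R : ℕ} (hR : 1 ≤ R) (N : ℕ) :
    ∑ m ∈ Finset.Icc 1 N, (m : ℝ) ^ (-1 - α) * min 1 ((d : ℝ) * (m : ℝ) ^ 2 / (R : ℝ) ^ 2)
      ≤ ((d : ℝ) * (1 + 1 / (2 - α)) + 1 / α) * (R : ℝ) ^ (-α) := by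
  have hR1 : (1 : ℝ) ≤ R := by exact_mod_cast hR
  have hR0 : (0 : ℝ) < R := by linarith
  have hα0 : 0 < α := by linarith
  rw [← Finset.sum_filter_add_sum_filter_not (Finset.Icc 1 N) (fun m => m ≤ R)]
  -- small shells
  have h1 : ∑ m ∈ (Finset.Icc 1 N).filter (fun m => m ≤ R),
      (m : ℝ) ^ (-1 - α) * min 1 ((d : ℝ) * (m : ℝ) ^ 2 / (R : ℝ) ^ 2)
      ≤ (d : ℝ) / (R : ℝ) ^ 2 * ∑ m ∈ Finset.Icc 1 R, (m : ℝ) ^ (1 - α) := by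
    have hsub : (Finset.Icc 1 N).filter (fun m => m ≤ R) ⊆ Finset.Icc 1 R := by
      intro m hm
      simp only [Finset.mem_filter, Finset.mem_Icc] at hm ⊢
      omega
    have hstep : ∑ m ∈ (Finset.Icc 1 N).filter (fun m => m ≤ R),
        (m : ℝ) ^ (-1 - α) * min 1 ((d : ℝ) * (m : ℝ) ^ 2 / (R : ℝ) ^ 2)
        ≤ ∑ m ∈ (Finset.Icc 1 N).filter (fun m => m ≤ R), (d : ℝ) / (R : ℝ) ^ 2 * (m : ℝ) ^ (1 - α) := by
      refine Finset.sum_le_sum fun m hm => ?_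
      have hm1 : (1 : ℝ) ≤ m := by
        simp only [Finset.mem_filter, Finset.mem_Icc] at hm; exact_mod_cast hm.1.1
      have hm0 : (0 : ℝ) < m := by linarith
      calc (m : ℝ) ^ (-1 - α) * min 1 ((d : ℝ) * (m : ℝ) ^ 2 / (R : ℝ) ^ 2)
          ≤ (m : ℝ) ^ (-1 - α) * ((d : ℝ) * (m : ℝ) ^ 2 / (R : ℝ) ^ 2) :=
            mul_le_mul_of_nonneg_left (min_le_right _ _) (Real.rpow_nonneg hm0.le _)
        _ = (d : ℝ) / (R : ℝ) ^ 2 * (m : ℝ) ^ (1 - α) := by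
            rw [show (1 - α) = (-1 - α) + 2 by ring, Real.rpow_add hm0, Real.rpow_two]
            ring
    have hstep2 : ∑ m ∈ (Finset.Icc 1 N).filter (fun m => m ≤ R), (d : ℝ) / (R : ℝ) ^ 2 * (m : ℝ) ^ (1 - α)
        ≤ ∑ m ∈ Finset.Icc 1 R, (d : ℝ) / (R : ℝ) ^ 2 * (m : ℝ) ^ (1 - α) :=
      Finset.sum_le_sum_of_subset_of_nonneg hsub fun m _ _ =>
        mul_nonneg (by positivity) (Real.rpow_nonneg (Nat.cast_nonneg m) _)
    rw [Finset.mul_sum]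
    exact hstep.trans hstep2
  -- large shells
  have h2 : ∑ m ∈ (Finset.Icc 1 N).filter (fun m => ¬ m ≤ R),
      (m : ℝ) ^ (-1 - α) * min 1 ((d : ℝ) * (m : ℝ) ^ 2 / (R : ℝ) ^ 2)
      ≤ ∑ m ∈ Finset.Ioc R N, (m : ℝ) ^ (-1 - α) := by
    have hsub : (Finset.Icc 1 N).filter (fun m => ¬ m ≤ R) ⊆ Finset.Ioc R N := by
      intro m hm
      simp only [Finset.mem_filter, Finset.mem_Icc, Finset.mem_Ioc] at hm ⊢
      omega
    have hstep : ∑ m ∈ (Finset.Icc 1 N).filter (fun m => ¬ m ≤ R),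
        (m : ℝ) ^ (-1 - α) * min 1 ((d : ℝ) * (m : ℝ) ^ 2 / (R : ℝ) ^ 2)
        ≤ ∑ m ∈ (Finset.Icc 1 N).filter (fun m => ¬ m ≤ R), (m : ℝ) ^ (-1 - α) :=
      Finset.sum_le_sum fun m _ =>
        mul_le_of_le_one_right (Real.rpow_nonneg (Nat.cast_nonneg m) _) (min_le_left _ _)
    exact hstep.trans (Finset.sum_le_sum_of_subset_of_nonneg hsub fun m _ _ =>
      Real.rpow_nonneg (Nat.cast_nonneg m) _)
  have h3 := sum_Icc_rpow_one_sub_le hα1 hα2 hR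
  have h4 := sum_Ioc_rpow_neg_le hα0 hR N
  have hd0 : (0 : ℝ) ≤ d := Nat.cast_nonneg d
  have hkey : (d : ℝ) / (R : ℝ) ^ 2 * ((1 + 1 / (2 - α)) * (R : ℝ) ^ (2 - α))
      = (d : ℝ) * (1 + 1 / (2 - α)) * (R : ℝ) ^ (-α) := by
    rw [show (2 - α) = -α + 2 by ring, Real.rpow_add hR0, Real.rpow_two]
    field_simp
  calc _ ≤ (d : ℝ) / (R : ℝ) ^ 2 * ∑ m ∈ Finset.Icc 1 R, (m : ℝ) ^ (1 - α)
          + ∑ m ∈ Finset.Ioc R N, (m : ℝ) ^ (-1 - α) := add_le_add h1 h2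
    _ ≤ (d : ℝ) / (R : ℝ) ^ 2 * ((1 + 1 / (2 - α)) * (R : ℝ) ^ (2 - α)) + (R : ℝ) ^ (-α) / α :=
        add_le_add (mul_le_mul_of_nonneg_left h3 (by positivity)) h4
    _ = ((d : ℝ) * (1 + 1 / (2 - α)) + 1 / α) * (R : ℝ) ^ (-α) := by rw [hkey]; ring

/-- The squared Euclidean length of a site is at most `d` times the square of its sup norm. -/
theorem sqLen_le_mul_supNorm_sq (y : Site d) :
    ∑ j, ((y j : ℝ)) ^ 2 ≤ (d : ℝ) * (Site.supNorm y : ℝ) ^ 2 := by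
  calc ∑ j, ((y j : ℝ)) ^ 2 ≤ ∑ _j : Fin d, (Site.supNorm y : ℝ) ^ 2 := by
        refine Finset.sum_le_sum fun j _ => ?_
        have h := Site.natAbs_le_supNorm y j
        have h2 : |(y j : ℝ)| ≤ (Site.supNorm y : ℝ) := by
          rw [show |(y j : ℝ)| = ((|y j| : ℤ) : ℝ) by push_cast; rfl]
          have : |y j| ≤ (Site.supNorm y : ℤ) := by
            rw [Int.abs_eq_natAbs]; exact_mod_cast h
          exact_mod_cast this
        calc ((y j : ℝ)) ^ 2 = |(y j : ℝ)| ^ 2 := (sq_abs _).symm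
          _ ≤ (Site.supNorm y : ℝ) ^ 2 := pow_le_pow_left₀ (abs_nonneg _) h2 2
    _ = (d : ℝ) * (Site.supNorm y : ℝ) ^ 2 := by
        rw [Finset.sum_const, Finset.card_univ, Fintype.card_fin, nsmul_eq_mul]

/-- `|∂Λ_m| ≤ 2d · 3^{d-1} · m^{d-1}` for `m ≥ 1`. -/
theorem card_sphere_le' (hd : 1 ≤ d) {m : ℕ} (hm : 1 ≤ m) :
    (#(sphere d m) : ℝ) ≤ 2 * d * 3 ^ (d - 1) * (m : ℝ) ^ (d - 1) := by
  obtain ⟨k, rfl⟩ : ∃ k, m = k + 1 := ⟨m - 1, by omega⟩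
  have h := card_sphere_succ_le (d := d) k
  have _ := hd
  calc (#(sphere d (k + 1)) : ℝ) ≤ 2 * d * (2 * k + 3 : ℝ) ^ (d - 1) := h
    _ ≤ 2 * d * (3 * ((k + 1 : ℕ) : ℝ)) ^ (d - 1) := by
        apply mul_le_mul_of_nonneg_left _ (by positivity)
        apply pow_le_pow_left₀ (by positivity)
        push_cast; linarith
    _ = 2 * d * 3 ^ (d - 1) * (((k + 1 : ℕ) : ℝ)) ^ (d - 1) := by rw [mul_pow]; ring

/-- **Box sums of the weighted kernel**: for `b(y) ≤ C‖y‖^{-(d+α)}` off the origin,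
`∑_{y ∈ Λ_N} b(y) min(1, |y|²/R²) ≤ C · 2d 3^{d-1} · (d(1+1/(2−α)) + 1/α) · R^{−α}`. -/
theorem box_sum_kernel_le (hd : 1 ≤ d) {b : Site d → ℝ} {C α : ℝ} (hC : 0 ≤ C) (hα1 : 1 < α)
    (hα2 : α < 2)
    (hup : ∀ y, y ≠ 0 → b y ≤ C * ‖y‖ ^ (-((d : ℝ) + α))) {R : ℕ} (hR : 1 ≤ R) (N : ℕ) :
    ∑ y ∈ box d N, b y * min 1 ((∑ j, ((y j : ℝ)) ^ 2) / (R : ℝ) ^ 2)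
      ≤ C * (2 * d * 3 ^ (d - 1)) * ((d : ℝ) * (1 + 1 / (2 - α)) + 1 / α) * (R : ℝ) ^ (-α) := by
  have hR0 : (0 : ℝ) < R := by exact_mod_cast hR
  rw [sum_box_eq_sum_sphere]
  -- shell `m = 0` contributes nothing, shells `m ≥ 1` are bounded by `|∂Λ_m| g(m)`
  have hshell : ∀ m ∈ Finset.range (N + 1), ∑ y ∈ sphere d m, b y * min 1 ((∑ j, ((y j : ℝ)) ^ 2) / (R : ℝ) ^ 2)
      ≤ if m = 0 then 0 else
        (2 * d * 3 ^ (d - 1)) * (C * ((m : ℝ) ^ (-1 - α) * min 1 ((d : ℝ) * (m : ℝ) ^ 2 / (R : ℝ) ^ 2))) := by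
    intro m _
    by_cases hm : m = 0
    · subst hm
      rw [if_pos rfl, sphere_zero, Finset.sum_singleton]
      simp
    · rw [if_neg hm]
      have hm1 : 1 ≤ m := Nat.one_le_iff_ne_zero.2 hm
      have hmpos : (0 : ℝ) < m := by exact_mod_cast hm1
      have hterm : ∀ y ∈ sphere d m, b y * min 1 ((∑ j, ((y j : ℝ)) ^ 2) / (R : ℝ) ^ 2)
          ≤ C * (m : ℝ) ^ (-((d : ℝ) + α)) * min 1 ((d : ℝ) * (m : ℝ) ^ 2 / (R : ℝ) ^ 2) := by
        intro y hy
        have hsn : Site.supNorm y = m := mem_sphere.1 hy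
        have hy0 : y ≠ 0 := by
          intro h; rw [h, Site.supNorm_eq_zero_iff.2 rfl] at hsn; omega
        have hnorm : ‖y‖ = (m : ℝ) := by rw [Site.norm_eq_supNorm, hsn]
        refine mul_le_mul ?_ ?_ (le_min zero_le_one (div_nonneg (sqLen_nonneg y) (sq_nonneg _)))
          (by positivity)
        · have := hup y hy0; rwa [hnorm] at this
        · refine min_le_min le_rfl (div_le_div_of_nonneg_right ?_ (sq_nonneg _))
          have := sqLen_le_mul_supNorm_sq y; rwa [hsn] at this
      calc ∑ y ∈ sphere d m, b y * min 1 ((∑ j, ((y j : ℝ)) ^ 2) / (R : ℝ) ^ 2)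
          ≤ ∑ y ∈ sphere d m, C * (m : ℝ) ^ (-((d : ℝ) + α)) * min 1 ((d : ℝ) * (m : ℝ) ^ 2 / (R : ℝ) ^ 2) :=
            Finset.sum_le_sum hterm
        _ = (#(sphere d m) : ℝ) * (C * (m : ℝ) ^ (-((d : ℝ) + α)) * min 1 ((d : ℝ) * (m : ℝ) ^ 2 / (R : ℝ) ^ 2)) := by
            rw [Finset.sum_const, nsmul_eq_mul]
        _ ≤ (2 * d * 3 ^ (d - 1) * (m : ℝ) ^ (d - 1))
              * (C * (m : ℝ) ^ (-((d : ℝ) + α)) * min 1 ((d : ℝ) * (m : ℝ) ^ 2 / (R : ℝ) ^ 2)) :=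
            mul_le_mul_of_nonneg_right (card_sphere_le' hd hm1)
              (mul_nonneg (mul_nonneg hC (Real.rpow_nonneg hmpos.le _)) (le_min zero_le_one (by positivity)))
        _ = (2 * d * 3 ^ (d - 1)) * (C * ((m : ℝ) ^ (-1 - α) * min 1 ((d : ℝ) * (m : ℝ) ^ 2 / (R : ℝ) ^ 2))) := by
            have hpow : (m : ℝ) ^ (d - 1) * (m : ℝ) ^ (-((d : ℝ) + α)) = (m : ℝ) ^ (-1 - α) := by
              rw [← Real.rpow_natCast, ← Real.rpow_add hmpos]
              congr 1
              rw [Nat.cast_sub hd]; push_cast; ring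
            rw [← hpow]; ring
  calc ∑ m ∈ Finset.range (N + 1), ∑ y ∈ sphere d m, b y * min 1 ((∑ j, ((y j : ℝ)) ^ 2) / (R : ℝ) ^ 2)
      ≤ ∑ m ∈ Finset.range (N + 1), (if m = 0 then 0 else
        (2 * d * 3 ^ (d - 1)) * (C * ((m : ℝ) ^ (-1 - α) * min 1 ((d : ℝ) * (m : ℝ) ^ 2 / (R : ℝ) ^ 2)))) :=
        Finset.sum_le_sum hshell
    _ = (2 * d * 3 ^ (d - 1)) * (C * ∑ m ∈ Finset.Icc 1 N,
          ((m : ℝ) ^ (-1 - α) * min 1 ((d : ℝ) * (m : ℝ) ^ 2 / (R : ℝ) ^ 2))) := by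
        rw [Finset.mul_sum, Finset.mul_sum]
        rw [Finset.range_eq_Ico, Finset.sum_eq_sum_Ico_succ_bot (by omega), if_pos rfl, zero_add,
          zero_add, Finset.Ico_add_one_right_eq_Icc]
        refine Finset.sum_congr rfl fun m hm => ?_
        rw [if_neg (by simp only [Finset.mem_Icc] at hm; omega)]
    _ ≤ (2 * d * 3 ^ (d - 1)) * (C * (((d : ℝ) * (1 + 1 / (2 - α)) + 1 / α) * (R : ℝ) ^ (-α))) := by
        apply mul_le_mul_of_nonneg_left _ (by positivity)
        exact mul_le_mul_of_nonneg_left (shell_sum_1d_le hα1 hα2 hR N) hC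
    _ = C * (2 * d * 3 ^ (d - 1)) * ((d : ℝ) * (1 + 1 / (2 - α)) + 1 / α) * (R : ℝ) ^ (-α) := by ring

/-- **The weighted kernel sum**: `∑_y b(y) min(1, |y|²/R²) ≤ C_shell R^{−α}`. -/
theorem tsum_kernel_le (hd : 1 ≤ d) {b : Site d → ℝ} {C α : ℝ} (hC : 0 ≤ C) (hα1 : 1 < α)
    (hα2 : α < 2) (hb0 : ∀ y, 0 ≤ b y) (hbs : Summable b)
    (hup : ∀ y, y ≠ 0 → b y ≤ C * ‖y‖ ^ (-((d : ℝ) + α))) {R : ℕ} (hR : 1 ≤ R) :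
    ∑' y, b y * min 1 ((∑ j, ((y j : ℝ)) ^ 2) / (R : ℝ) ^ 2)
      ≤ C * (2 * d * 3 ^ (d - 1)) * ((d : ℝ) * (1 + 1 / (2 - α)) + 1 / α) * (R : ℝ) ^ (-α) := by
  have hnn : ∀ y, 0 ≤ b y * min 1 ((∑ j, ((y j : ℝ)) ^ 2) / (R : ℝ) ^ 2) := fun y =>
    mul_nonneg (hb0 y) (le_min zero_le_one (div_nonneg (sqLen_nonneg y) (sq_nonneg _)))
  have hs : Summable (fun y => b y * min 1 ((∑ j, ((y j : ℝ)) ^ 2) / (R : ℝ) ^ 2)) :=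
    Summable.of_nonneg_of_le hnn (fun y => mul_le_of_le_one_right (hb0 y) (min_le_left _ _)) hbs
  refine hs.tsum_le_of_sum_le fun s => ?_
  obtain ⟨N, hN⟩ : ∃ N, s ⊆ box d N :=
    ⟨s.sup Site.supNorm, fun x hx => mem_box_iff_supNorm_le.2 (Finset.le_sup (f := Site.supNorm) hx)⟩
  exact (Finset.sum_le_sum_of_subset_of_nonneg hN fun y _ _ => hnn y).trans
    (box_sum_kernel_le hd hC hα1 hα2 hup hR N)


/-- **Lower bound on box sums (test-function argument)**: under the infinite-volume equation
`A₀G − b∗G = δ` with `∑ b = A₀` (no killing), `b` even, `0 ≤ b(y) ≤ C‖y‖^{-(d+α)}` off the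
origin (`1 < α < 2`) and `0 ≤ G ≤ G₀`, one has `∑_{u ∈ Λ_R} G(u) ≥ R^α / C_shell` for `R ≥ 1`,
`C_shell = C · 2d3^{d-1} · (d(1+1/(2−α)) + 1/α)`: pair the equation with the quadratic bump
`θ_R`, for which `−Lθ_R ≤ C_shell R^{−α}` inside the ball and `≤ 0` outside. -/
theorem box_sum_lower (hd : 1 ≤ d) {G b : Site d → ℝ} {A₀ G₀ C α : ℝ} (hG0 : ∀ u, 0 ≤ G u)
    (hGle : ∀ u, G u ≤ G₀) (hb0 : ∀ y, 0 ≤ b y) (hbs : Summable b) (hbev : ∀ y, b (-y) = b y)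
    (hbA : ∑' y, b y = A₀)
    (heq : ∀ z, A₀ * G z - ∑' y, b y * G (z - y) = if z = 0 then 1 else 0)
    (hC : 0 < C) (hα1 : 1 < α) (hα2 : α < 2)
    (hup : ∀ y, y ≠ 0 → b y ≤ C * ‖y‖ ^ (-((d : ℝ) + α))) {R : ℕ} (hR : 1 ≤ R) :
    (R : ℝ) ^ α / (C * (2 * d * 3 ^ (d - 1)) * ((d : ℝ) * (1 + 1 / (2 - α)) + 1 / α))
      ≤ ∑ u ∈ box d R, G u := by
  have hR0 : (0 : ℝ) < R := by exact_mod_cast hR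
  have hdpos : (0 : ℝ) < d := by exact_mod_cast hd
  have hα0 : 0 < α := by linarith
  set Cs : ℝ := C * (2 * d * 3 ^ (d - 1)) * ((d : ℝ) * (1 + 1 / (2 - α)) + 1 / α) with hCs
  have hCs0 : 0 < Cs := by
    have : (0:ℝ) < 2 - α := by linarith
    positivity
  set θ : Site d → ℝ := fun v => max 0 (1 - (∑ j, ((v j : ℝ)) ^ 2) / (R : ℝ) ^ 2) with hθ
  have hθ1 : ∀ v, |θ v| ≤ 1 := fun v => abs_bump_le_one v
  have hθF : ∀ u, u ∉ box d R → θ u = 0 := by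
    intro u hu
    simp only [hθ]
    refine max_eq_left ?_
    rw [sub_nonpos, le_div_iff₀ (by positivity), one_mul]
    by_contra h
    exact hu (mem_box_of_sqLen_lt (not_le.1 h))
  have hθ0 : θ 0 = 1 := by simp [hθ]
  -- summation by parts
  have hsbp := summation_by_parts hG0 hGle hb0 hbs hbA heq (zero_mem_box d R) hθF hθ1
  rw [hθ0] at hsbp
  -- the kernel sum `T`
  set T : ℝ := ∑' y, b y * min 1 ((∑ j, ((y j : ℝ)) ^ 2) / (R : ℝ) ^ 2) with hT
  have hT0 : 0 ≤ T := tsum_nonneg fun y =>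
    mul_nonneg (hb0 y) (le_min zero_le_one (div_nonneg (sqLen_nonneg y) (sq_nonneg _)))
  have hTle : T ≤ Cs * (R : ℝ) ^ (-α) := tsum_kernel_le hd hC.le hα1 hα2 hb0 hbs hup hR
  -- pointwise bound `G u (−Lθ u) ≤ 𝟙_{Λ_R}(u) G u T`
  have hpt : ∀ u, G u * ∑' y, b y * (θ u - θ (u + y)) ≤ if u ∈ box d R then G u * T else 0 := by
    intro u
    by_cases hin : ∑ j, ((u j : ℝ)) ^ 2 < (R : ℝ) ^ 2
    · rw [if_pos (mem_box_of_sqLen_lt hin)]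
      exact mul_le_mul_of_nonneg_left (neg_L_bump_le hb0 hbs hbev hR0 hin) (hG0 u)
    · have h1 := neg_L_bump_nonpos (b := b) hb0 (not_lt.1 hin) hR0 (u := u)
      have h2 : G u * ∑' y, b y * (θ u - θ (u + y)) ≤ 0 :=
        mul_nonpos_of_nonneg_of_nonpos (hG0 u) h1
      refine h2.trans ?_
      split_ifs
      · exact mul_nonneg (hG0 u) hT0
      · exact le_rfl
  have hsumR : Summable (fun u => if u ∈ box d R then G u * T else 0) :=
    summable_of_ne_finset_zero (s := box d R) (fun u hu => if_neg hu)
  have hle : (1 : ℝ) ≤ T * ∑ u ∈ box d R, G u := by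
    calc (1 : ℝ) = ∑' u, G u * ∑' y, b y * (θ u - θ (u + y)) := hsbp
      _ ≤ ∑' u, (if u ∈ box d R then G u * T else 0) :=
          Summable.tsum_le_tsum hpt (summable_outer_bump hG0 hGle hb0 hbs hθF hθ1) hsumR
      _ = ∑ u ∈ box d R, (if u ∈ box d R then G u * T else 0) := tsum_eq_sum (fun u hu => if_neg hu)
      _ = ∑ u ∈ box d R, G u * T := Finset.sum_congr rfl fun u hu => if_pos hu
      _ = T * ∑ u ∈ box d R, G u := by rw [Finset.mul_sum]; refine Finset.sum_congr rfl fun u _ => ?_; ring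
  have hSnn : 0 ≤ ∑ u ∈ box d R, G u := Finset.sum_nonneg fun u _ => hG0 u
  have hle2 : (1 : ℝ) ≤ Cs * (R : ℝ) ^ (-α) * ∑ u ∈ box d R, G u :=
    hle.trans (mul_le_mul_of_nonneg_right hTle hSnn)
  rw [Real.rpow_neg hR0.le] at hle2
  have hRα : 0 < (R : ℝ) ^ α := Real.rpow_pos_of_pos hR0 _
  rw [div_le_iff₀ hCs0]
  have := mul_le_mul_of_nonneg_left hle2 hRα.le
  rw [mul_one] at this
  calc (R : ℝ) ^ α ≤ (R : ℝ) ^ α * (Cs * ((R : ℝ) ^ α)⁻¹ * ∑ u ∈ box d R, G u) := this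
    _ = (∑ u ∈ box d R, G u) * Cs := by field_simp

end Shell

end Summit.CriticalPhenomena.Ising3DConformalLimit.Theorems.EtaBoundsTransfer
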